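import Mathlib
import HarnessLib
import HarnessLib.Audit
import Summits.Langlands.Langlands.Theses.ParahoricFibre

/-!
# ParahoricFibreAssembly — the assembly item of route-Langlands-ParahoricFibre, proved outright

Closes item stmt-Langlands-18197 `Summit.Langlands.Langlands.Theses.ParahoricFibre.Assembly`
(kind assembly, rank 1; a LOAD-BEARING binder of the route's deciding theorem
`ParahoricFibre.closes … (hA : Assembly) : Langlands := hA hOcc hOG hSmall hJ`):

  `Assembly := ParahoricOccurrence → OccurrenceToGeneric → SmallRangeGenericMonodromy → MonodromyToLanglands → Langlands`.

Proof (pure logic, no literature input): excluded middle on the patching-range predicate of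
`OccurrenceToGeneric` / `SmallRangeGenericMonodromy` gives the route target `GenericMonodromy`
(in range: `OccurrenceToGeneric ∘ ParahoricOccurrence`; off range: `SmallRangeGenericMonodromy`),
and `MonodromyToLanglands` carries it to the summit.  This is the argument recorded on the item by
grounder g87-0 (2026-08-17) and referee g16 (2026-08-29, evidence `P18197.lean`), landed here as a
Theorems file so that the gate can close the item BY NAME.

No `sorry`, no new `def`/`instance`/`notation`; axioms = the standard trio at most.
-/

set_option linter.dupNamespace false

namespace Summit.Langlands.Langlands.Theorems.ParahoricFibreAssembly

open Summit.Langlands.Langlands.Theses.ParahoricFibre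

/-- Item stmt-Langlands-18197, typed BY NAME as the route decl: excluded middle on the patching-range
predicate of `OccurrenceToGeneric` / `SmallRangeGenericMonodromy` gives the route target, and
`MonodromyToLanglands` carries it to the summit.  (Kept as ONE theorem so that the file audit sees
exactly one proof-of-item: the intermediate `GenericMonodromy`-valued step is not stated separately.) -/
theorem assembly_proof : Assembly := by
  intro hOcc hOG hSmall hJ
  refine hJ ?_
  intro K _ _ hCM n hcpt π hπ p _ ι ρ hss hcompat v hv
  exact (Classical.em _).elim
    (fun hR => hOG hOcc K hCM n hcpt π hπ p ι ρ hss hcompat hR v hv)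
    (fun hR => hSmall K hCM n hcpt π hπ p ι ρ hss hcompat hR v hv)

/-- info: 'Summit.Langlands.Langlands.Theorems.ParahoricFibreAssembly.assembly_proof' depends on axioms: [propext, Classical.choice, Quot.sound] -/
#guard_msgs (whitespace := lax) in
#print axioms assembly_proof

end Summit.Langlands.Langlands.Theorems.ParahoricFibreAssembly
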